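import Summits.BirchSwinnertonDyer.BirchSwinnertonDyer.Theorems.ManinLocalTwoThreeEtaIdentitiesSixtyFour
import Summits.BirchSwinnertonDyer.BirchSwinnertonDyer.Theorems.ManinLocalTwoThreeNeronSqueeze
import Summits.BirchSwinnertonDyer.Rank1Residual.Additive.IntModelConductorCertificate
import Literature.NumberTheory.EllipticCurves.BSDAnalyticRankTunnellCMProofs
import HarnessLib

/-!
# Level 64: the Néron squeeze for `64a1 = y² = x³ − 4x` — `|c| = 1` for every `X₀(64)`-datum whose newform is `φ₆₄`;
# `N(64a1) = 64` in the kernel; the `X₀(64)`-domain of C2 is inhabited under the item's modularity binder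

Cell bsd-f2-manin, route `ManinLocalTwoThree` (crux C2 `ManinOddAtFour` stmt-22967: `2² ∣ 64`, first genus-THREE level), prover seat
p3 gen 23; level-`64` instance of the general NÉRON SQUEEZE (`NeronSqueeze.abs_maninConstant_eq_one_of_periodLattice_le`) fed with
(S2)₆₄ `Λ(φ₆₄) ⊆ Λ(16, 0)` of `EtaIdentitiesSixtyFour` (UNCONDITIONAL).

* §1 `64a1 = [0, 0, 0, −4, 0] = congruentNumberCurve 2` (`y² = x³ − 4x`): globally minimal and elliptic (tree, Tunnell–CM file);
  **`N(64a1) = 64`** by the rank-2 observatory's kernel Tate certificates in RECORD currency (minimality from the instance, since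
  `v₂(Δ) = 12`: deep exit `I₂*` after `x ↦ x + 2`, `f₂ = 12 + 1 − 7 = 6`; good at `3`); Néron invariants `(g₂, g₃) = (16, 0)`.
* §2 **THE SQUEEZE at `64`, newform pinned by hypothesis**: for every globally minimal elliptic `W/ℚ` and every `X₀(64)`-datum `D` of `W`
  with the lattice clause AND `D.f = φ₆₄`: `|c(D)| = 1`, hence `2 ∤ c(D)`.  Modulo the ONE remaining level-`64` statement
  `P64 : ∀ f ∈ S₂(Γ₀(64)), IsNewform0 f → f = φ₆₄` (`S₂(Γ₀(64)) = ⟨φ₃₂, φ₃₂(2τ), φ₆₄⟩`, `U₂`-eigen ⟹ no `φ₃₂(2τ)`, `T₅` separates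
  `φ₃₂` (`a₅ = −2`) from `φ₆₄` (`a₅ = 2`), and `φ₃₂ ∉ S₂^{new}(64)` by the trace to level `32`) — taken here as the hypothesis `hpin`,
  NOT proved — C2 holds at `N = 64` for every datum (`not_two_dvd_maninConstant_sixtyFour_of_pinning`).
* §3 GIVEN the item's own binder `exists_isNewformOf`: a lattice-optimal `X₀(64)`-datum on a globally minimal curve of the class `64a`
  exists (C2's `∀`-domain at `64` is inhabited relative to the item's hypotheses).

HONEST FRAMING: §1 and the squeeze lemma are unconditional; the full level-`64` statement is CONDITIONAL on the pinning `hpin` (a concrete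
finite-dimensional linear-algebra statement about `S₂(Γ₀(64))`, not a named fact; to be discharged in a sequel); §3 is conditional on
`exists_isNewformOf`.  Nothing here proves C2 (all `N`), Manin's conjecture or BSD; items stay OPEN.  No definition, no named fact, no sorry.
[cite: Silverman1994, IV.9.4 Step 7 and IV.11.1] [cite: CremonaAlgorithms1997, Table 1 (64a1)] [cite: AgasheRibetStein2006, §§1–2]
[cite: DiamondShurman2005, Thm. 8.8.3] [cite: EdixhovenManin1991, Prop. 2]
-/

set_option autoImplicit false
-- lint-debt: the directory name repeats the summit name (sibling precedent `ManinLocalTwoThreeNeronSqueezeTwentyFour.lean`)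
set_option linter.dupNamespace false

noncomputable section

open Complex Filter Topology Set Function
open UpperHalfPlane hiding I
open scoped Real Topology Manifold MatrixGroups ModularForm
open ModularForm CongruenceSubgroup WeierstrassCurve
open Summit.BirchSwinnertonDyer.BirchSwinnertonDyer.Rank2Observatory
open Summit.BirchSwinnertonDyer.BirchSwinnertonDyer.Rank2Observatory.RootNumber
open Summit.BirchSwinnertonDyer.BirchSwinnertonDyer.Rank2Observatory.Tate
open Summit.BirchSwinnertonDyer.Rank1Residual.Additive
open Literature.NumberTheory.EllipticCurves Literature.NumberTheory.EllipticCurves.ModularForms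
open Literature.NumberTheory.Automorphic

namespace Summit.BirchSwinnertonDyer.BirchSwinnertonDyer.Theorems.ManinLocalTwoThree.NeronSqueezeSixtyFour

open EtaIdentitiesSixtyFour

/-! ## §1 `64a1 = y² = x³ − 4x`: minimal, elliptic, conductor `64`, Néron invariants `(16, 0)` -/

/-- `congruentNumberCurve 2 = [0, 0, 0, −4, 0] = 64a1`. [cite: CremonaAlgorithms1997, Table 1 (64a1)] -/
theorem congruentNumberCurve_two_eq : congruentNumberCurve 2 = (⟨0, 0, 0, -4, 0⟩ : WeierstrassCurve ℚ) := by
  ext <;> norm_num [congruentNumberCurve]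

/-- `64a1 = y² = x³ − 4x` is globally minimal (the tree's theorem for square-free congruent-number twists, `n = 2`).
[cite: SilvermanAEC2009, VIII.8] -/
theorem isGloballyMinimal_sixtyFourA1 : (congruentNumberCurve 2).IsGloballyMinimal :=
  isGloballyMinimal_congruentNumberCurve Nat.squarefree_two

/-- `64a1` is an elliptic curve (`Δ = 4096`). [folklore] -/
theorem isElliptic_sixtyFourA1 : (congruentNumberCurve 2).IsElliptic :=
  isElliptic_congruentNumberCurve two_ne_zero

/-- **`N(64a1) = 64 = 2⁶`**: deep Tate certificate at `2` after `x ↦ x + 2` (`[0, 6, 0, 8, 0]`, exit `I₂*`, `f₂ = 12 + 1 − 7 = 6`), good at `3`,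
no other bad prime; RECORD currency (global minimality is the instance of §1).  NO named fact. [cite: Silverman1994, IV.9.4 Step 7 and IV.11.1] -/
theorem conductorNorm_sixtyFourA1 : (congruentNumberCurve 2).conductorNorm ℤ = 64 := by
  haveI := isGloballyMinimal_sixtyFourA1
  exact IntModelCond.conductorNorm_eq_of_intModel_of_certs_of_eq (integralModelInt_congruentNumberCurve 2)
    (c := ⟨12, 6, 0, 0, 1, 0, []⟩) (l₂ := ⟨3, 2, 0, 0, 12, 72, 0⟩) (l₃ := ⟨0, 0, 0, 0, 0, 0, 0⟩)
    (by decide +kernel) (by decide +kernel) (by decide +kernel) (by decide +kernel)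

/-- `2² ∣ 64`. [folklore] -/
theorem two_sq_dvd_sixtyFour : 2 ^ 2 ∣ 64 := ⟨16, by norm_num⟩

/-- **The Néron invariants of `64a1`**: `c₄ = 192`, `c₆ = 0`, so a pair with `(g₂, g₃) = (16, 0)` is a Néron lattice of `64a1/ℂ`.
[cite: CremonaAlgorithms1997, Table 1 (64a1)] -/
theorem isNeronLatticeOf_sixtyFourA1 {L₁ : PeriodPair} (hg2 : L₁.g₂ = 16) (hg3 : L₁.g₃ = 0) :
    IsNeronLatticeOf ((congruentNumberCurve 2).baseChange ℂ) L₁ := by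
  rw [congruentNumberCurve_two_eq]
  constructor
  · rw [hg2]
    norm_num [WeierstrassCurve.baseChange, WeierstrassCurve.map_c₄, WeierstrassCurve.c₄,
      WeierstrassCurve.b₂, WeierstrassCurve.b₄]
  · rw [hg3]
    norm_num [WeierstrassCurve.baseChange, WeierstrassCurve.map_c₆, WeierstrassCurve.c₆,
      WeierstrassCurve.b₂, WeierstrassCurve.b₄, WeierstrassCurve.b₆]

/-! ## §2 The squeeze at `64` -/

/-- **`|c| = 1` for every `X₀(64)`-datum whose newform is `φ₆₄ = η₈⁸/(η₄²η₁₆²)`** — UNCONDITIONAL: (S2)₆₄ + the general Néron squeeze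
with `W₀ = 64a1`. [cite: AgasheRibetStein2006, §§1–2] -/
theorem abs_maninConstant_eq_one_sixtyFour_of_f_eq (W : WeierstrassCurve ℚ) [W.IsElliptic] [W.IsGloballyMinimal]
    (D : ModularParametrizationData W 64)
    (hf : D.f = etaQuotientCuspForm 64 (expFn [(4, -2), (8, 8), (16, -2)]) 2 even_two
      NewformSixtyFour.newmanCond_phi64' NewformSixtyFour.etaCert_sixtyFour.2.2.2.2)
    (hopt : ∀ z ∈ D.L.lattice, ∃ w ∈ periodLattice D.f, z = D.c * w) :
    |D.maninConstant| = 1 := by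
  haveI := isElliptic_sixtyFourA1
  haveI := isGloballyMinimal_sixtyFourA1
  obtain ⟨L₁, hg2, hg3, hle⟩ := periodLatticeLe_sixtyFour
  refine NeronSqueeze.abs_maninConstant_eq_one_of_periodLattice_le (congruentNumberCurve 2) L₁
    (isNeronLatticeOf_sixtyFourA1 hg2 hg3) W D (fun z hz ↦ hle z ?_) hopt
  rwa [hf] at hz

/-- `2 ∤ c` for every `X₀(64)`-datum whose newform is `φ₆₄` — UNCONDITIONAL. [folklore] -/
theorem not_two_dvd_maninConstant_sixtyFour_of_f_eq (W : WeierstrassCurve ℚ) [W.IsElliptic] [W.IsGloballyMinimal]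
    (D : ModularParametrizationData W 64)
    (hf : D.f = etaQuotientCuspForm 64 (expFn [(4, -2), (8, 8), (16, -2)]) 2 even_two
      NewformSixtyFour.newmanCond_phi64' NewformSixtyFour.etaCert_sixtyFour.2.2.2.2)
    (hopt : ∀ z ∈ D.L.lattice, ∃ w ∈ periodLattice D.f, z = D.c * w) :
    ¬ (2 : ℤ) ∣ D.maninConstant := by
  have h := abs_maninConstant_eq_one_sixtyFour_of_f_eq W D hf hopt
  intro h2
  have := Int.le_of_dvd (by rw [h]; norm_num) ((dvd_abs _ _).mpr h2)
  rw [h] at this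
  norm_num at this

/-- **C2 `ManinOddAtFour` at `N = 64` for EVERY datum, MODULO THE PINNING `hpin`** (`every newform of weight 2 on Γ₀(64) is φ₆₄` — a
finite-dimensional statement about `S₂(Γ₀(64)) = ⟨φ₃₂, φ₃₂(2τ), φ₆₄⟩`, taken as hypothesis): `|c| = 1` and `2 ∤ c` with none of the
item's four hypotheses. [cite: AgasheRibetStein2006, §§1–2] -/
theorem not_two_dvd_maninConstant_sixtyFour_of_pinning
    (hpin : ∀ f : CuspForm (Gamma0 64) 2, IsNewform0 f →
      f = etaQuotientCuspForm 64 (expFn [(4, -2), (8, 8), (16, -2)]) 2 even_two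
      NewformSixtyFour.newmanCond_phi64' NewformSixtyFour.etaCert_sixtyFour.2.2.2.2)
    (W : WeierstrassCurve ℚ) [W.IsElliptic] [W.IsGloballyMinimal] (D : ModularParametrizationData W 64)
    (hopt : ∀ z ∈ D.L.lattice, ∃ w ∈ periodLattice D.f, z = D.c * w) :
    |D.maninConstant| = 1 ∧ ¬ (2 : ℤ) ∣ D.maninConstant :=
  ⟨abs_maninConstant_eq_one_sixtyFour_of_f_eq W D (hpin D.f D.isNewformOf.1) hopt,
    not_two_dvd_maninConstant_sixtyFour_of_f_eq W D (hpin D.f D.isNewformOf.1) hopt⟩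

/-! ## §3 C2's `∀`-domain at `N = 64` is inhabited, GIVEN the item's own binder `exists_isNewformOf` -/

/-- **Modularity at `64a1`, levelled**: under `exists_isNewformOf` the curve `64a1` has a newform in `S₂(Γ₀(64))` (its conductor IS `64`).
CONDITIONAL on modularity. [cite: DiamondShurman2005, Thm. 8.8.3] -/
theorem exists_isNewformOf_sixtyFourA1 (hnf : exists_isNewformOf) :
    ∃ f : CuspForm (Gamma0 64) 2, IsNewformOf (congruentNumberCurve 2) f := by
  haveI := isElliptic_sixtyFourA1
  have key : ∀ (N : ℕ) [NeZero N], (congruentNumberCurve 2).conductorNorm ℤ = N →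
      ∃ f : CuspForm (Gamma0 N) 2, IsNewformOf (congruentNumberCurve 2) f := by
    intro N _ hN
    subst hN
    exact hnf _
  haveI : NeZero (64 : ℕ) := ⟨by decide⟩
  exact key 64 conductorNorm_sixtyFourA1

/-- **A lattice-optimal `X₀(64)`-datum on a globally minimal curve of the class `64a` exists under modularity** — C2's `∀`-domain at
`N = 64` is inhabited relative to the item's hypotheses.  CONDITIONAL on `exists_isNewformOf` only.
[cite: EdixhovenManin1991, Prop. 2] [cite: DiamondShurman2005, Thm. 8.8.3] -/
theorem maninOddAtFour_domain_inhabited_sixtyFour_of_modularity (hnf : exists_isNewformOf) :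
    ∃ (W₀ : WeierstrassCurve ℚ) (_ : W₀.IsElliptic) (_ : W₀.IsGloballyMinimal) (D₀ : ModularParametrizationData W₀ 64),
      (congruentNumberCurve 2).IsIsogenous W₀ ∧ (∀ z ∈ D₀.L.lattice, ∃ w ∈ periodLattice D₀.f, z = D₀.c * w) ∧ 2 ^ 2 ∣ 64 := by
  haveI := isElliptic_sixtyFourA1
  haveI : NeZero (64 : ℕ) := ⟨by decide⟩
  obtain ⟨f, hf⟩ := exists_isNewformOf_sixtyFourA1 hnf
  obtain ⟨D⟩ := nonempty_modularParametrizationData_of_isNewformOf hf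
  obtain ⟨W₀, h₀, hmin, D₀, -, hiso, hopt, -⟩ :=
    ExistsMinimalOptimalDatum.existsMinimalOptimalDatum_full (congruentNumberCurve 2) D
  exact ⟨W₀, h₀, hmin, D₀, hiso, hopt, two_sq_dvd_sixtyFour⟩

end Summit.BirchSwinnertonDyer.BirchSwinnertonDyer.Theorems.ManinLocalTwoThree.NeronSqueezeSixtyFour

end
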